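import Summits.QuantumFields.BalabanUV.T4Continuum.Support.NE7FlatHkRightInverse
import Summits.QuantumFields.BalabanUV.T4Continuum.Support.NE7LinOneStepAbelian
import Summits.QuantumFields.BalabanUV.T4Continuum.Support.NE3SmoothRightInverseCurl
import Summits.QuantumFields.BalabanUV.T4Continuum.Support.NE7TorusBoxDictionary
import Literature.Computability.QuantumComplexity.SolovayKitaev.Basic
import HarnessLib

/-!
# NE7FlatHkCurlLetter — BRICK 3 OF THE BRIDGE: the CURL DICTIONARY (T4 flat `curlAt` of a pull-back = lit-balaban's plaquette field `Fs`, entrywise)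
# and THE (R7♭) LETTER IN KERNEL: the exact right inverse of brick 2 (lit-balaban's `H_k` pulled back + row NE3's curl-free corrector) has FINE CURVATURE
# BOUNDED BY THE COARSE CURVATURE OF ITS DATUM — `‖curl_1(R_H B)(z)‖ ≤ card n·C_LIN(d)·n⁻¹·sup‖F¹(B)‖` (gen 65's LIN-ONE-STEP read in the T4 dictionary)

Cell `pub-balaban`, rung (B)+1 sub-cell t4, lineage `b2b-balaban-t4-ne7-p1`, generation 69 (CRUX PROVER NE7 #1); memo
`t4/b2b-balaban-t4-ne7-p1-g69/HUNT-H13-ROUTE-PI-TRANSPOSED.md` §5–§6 (2).  File F37 (over F36 `NE7FlatHkRightInverse`, gen 65's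
`NE7LinOneStepAbelian.norm_curl_HkOp_le_curl`, row NE3's `NE3SmoothRightInverseCurl.curlAt_flat_dPot ∕ curlAt_flat_add`, `NE3SmoothLiftCurl.curlAt_flat_eq`).
WHY.  Memo H13 §5 (ii): (APE)'s normal part needs a lift whose CURL is controlled by the CURL of the datum ((R7)), not by its size — row NE3's bump lift has
(R6′) only.  Gen 65 proved exactly this for lit-balaban's `H_k` in THEIR dictionary (`Fs (fine n M) n (H_kB)` against `Fs M 1 B`, constant `C_LIN(d)` of the
dimension only).  F35∕F36 made `H_k` (pulled back entrywise, corrected) an exact right inverse of the T4 linearised average at `U = 1`; THIS FILE carries the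
curl letter across: the T4 flat curl of an entrywise pull-back IS `Fs` with `c = 1` entry by entry, the corrector is curl-free, and the operator norm of a
matrix is at most `card n` times its largest entry.
WHAT ([folklore]; 0 def, 0 sorry; dimension written `d + 1` as in gen 65 ∕ lit-balaban's torus kernel files).
§1 **`curlAt_flat_pullback_entry`** (`(curl_1 Ã)(z;μ,ν)_{ij} = Fs N 1 A_{ij} μ ν (toT z)`), `Fs_one_eq`
   (`Fs N 1 A = c⁻¹·Fs N c A`).
§2 `opNorm_le_card_mul` (`(∀ i j, ‖X_{ij}‖ ≤ m) ⇒ ‖X‖ ≤ card n·m`).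
§3 **`norm_curlAt_flat_hkRightInverse_le`** — THE (R7♭) LETTER: for `B : Tor M × Fin (d+1) → Matrix n n ℂ` with `‖Fs M 1 B_{ij} μ ν y‖ ≤ f` for all entries,
   coarse points and planes, the brick-2 right inverse `R_H B := A_H + dPot (interp n univ (framePot L (j+1) A_H))` (`n = L^{j+1}`) obeys, at EVERY fine point
   and plane, `‖curlAt flat (R_H B) z μ ν‖ ≤ card n·(C_LIN(d)∕n)·f`, `C_LIN(d)` = gen 65's constant (dimension only) — uniform in `n = L^{j+1}` and in the torus.
HONEST FRAMING (page 1): dictionary bookkeeping over gen 65's kernel theorem (abelian, flat, `U = 1`); the holonomy twist (brick 4), the sup∕locality letters and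
(L4♯) (brick 5) are NOT here; nothing of Bałaban's asserted; NOT (APE), NOT ONE-STEP, NOT NE7; spine 0∕9; finite T⁴ rung (B)+1 — NOT infinite volume, NOT mass gap,
NOT Clay.  Continuum YM on T⁴ ⇐ BetaPertH ∧ nine spine estimates (0/9 proved); BetaPertH ⇐ (D1) ∧ (D4) ∧ CAP+tail; G-an2-4 gates asym, D1 and NE2/3/4.
-/

set_option autoImplicit false

open scoped BigOperators Matrix Matrix.Norms.L2Operator
open Finset

namespace Summit.QuantumFields.BalabanUV.T4Continuum.NE7FlatHkCurlLetter

open Literature.MathematicalPhysics.QuantumFieldTheory.Balaban1983to89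
open B7Prop1Explicit (Site e e_apply)
open T4AveragingDeficitWall (curlAt)
open B4Sect5Proof (latticeConst)
open B5Prop11Plancherel (Tor fine)
open B5Action121 (Fs Fs_apply)
open B5Hk163Strip (kappa163)
open B5Hk163Torus (HkOp)
open B5Hk163TorusHolderDecay (CdecD)
open B6LowerBound2153Torus (toT toT_add)
open BlockAveragePushDirSplit (flat)
open SmoothRefineInterp (interp)
open NE3TangentNoGoWords (dPot)
open NE3TangentFlatStructure (framePot)
open NE3SmoothLiftCurl (curlAt_flat_eq)
open NE3SmoothRightInverseCurl (curlAt_flat_dPot curlAt_flat_add)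
open MatrixNorms (sum_norm_sq_col_le_opNorm_sq opNorm_sq_le_card_mul_nhsNormSq card_mul_nhsNormSq)
open NE7LinOneStepAbelian (norm_curl_HkOp_le_curl)
open NE7TorusBoxDictionary (toT_add_e')
open Literature.Computability.QuantumComplexity.SolovayKitaev (norm_apply_le_norm)

noncomputable section

variable {d : ℕ} {n : Type*} [Fintype n] [DecidableEq n]

/-! ## §1 The curl dictionary -/

/-- **THE T4 FLAT CURL OF AN ENTRYWISE PULL-BACK IS lit-balaban's PLAQUETTE FIELD `Fs` (c = 1), ENTRY BY ENTRY**: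
`(curlAt flat Ã z μ ν) i j = Fs N 1 (A i j) μ ν (toT z)` for `Ã(x,κ)_{ij} = A_{ij}(toT x, κ)`. [folklore] -/
theorem curlAt_flat_pullback_entry (N : Fin d → ℕ) [∀ μ, NeZero (N μ)] (A : n → n → (Tor N × Fin d → ℂ)) (z : Site d) (μ ν : Fin d) (i j : n) :
    curlAt (flat (d := d) (n := n)) (fun (x : Site d) (κ : Fin d) => Matrix.of fun i' j' : n => A i' j' (toT N x, κ)) z μ ν i j
      = Fs N 1 (A i j) μ ν (toT N z) := by
  rw [curlAt_flat_eq, Fs_apply, toT_add_e', toT_add_e']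
  simp only [Matrix.sub_apply, Matrix.of_apply, one_mul]
  ring

omit [Fintype n] [DecidableEq n] in
/-- `Fs N 1 A = c⁻¹·Fs N c A` for `c ≠ 0`. [folklore] -/
theorem Fs_one_eq (N : Fin d → ℕ) [∀ μ, NeZero (N μ)] {c : ℂ} (hc : c ≠ 0) (A : Tor N × Fin d → ℂ) (μ ν : Fin d) (x : Tor N) :
    Fs N 1 A μ ν x = c⁻¹ * Fs N c A μ ν x := by
  rw [Fs_apply, Fs_apply, one_mul, ← mul_assoc, inv_mul_cancel₀ hc, one_mul]

/-! ## §2 Entries and the operator norm -/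

/-- `(∀ i j, ‖X_{ij}‖ ≤ m) ⇒ ‖X‖ ≤ card n·m`. [folklore] -/
theorem opNorm_le_card_mul [Nonempty n] (X : Matrix n n ℂ) {m : ℝ} (hm : ∀ i j, ‖X i j‖ ≤ m) : ‖X‖ ≤ Fintype.card n * m := by
  have hm0 : 0 ≤ m := (norm_nonneg _).trans (hm (Classical.arbitrary n) (Classical.arbitrary n))
  have h1 : ‖X‖ ^ 2 ≤ ∑ i, ∑ j, ‖X i j‖ ^ 2 := by
    rw [← card_mul_nhsNormSq]; exact opNorm_sq_le_card_mul_nhsNormSq X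
  have h2 : ∑ i, ∑ j, ‖X i j‖ ^ 2 ≤ ∑ _i : n, ∑ _j : n, m ^ 2 :=
    Finset.sum_le_sum fun i _ => Finset.sum_le_sum fun j _ => pow_le_pow_left₀ (norm_nonneg _) (hm i j) 2
  have h3 : ∑ _i : n, ∑ _j : n, m ^ 2 = (Fintype.card n * m) ^ 2 := by
    simp only [Finset.sum_const, Finset.card_univ, nsmul_eq_mul]; ring
  have h4 : ‖X‖ ^ 2 ≤ (Fintype.card n * m) ^ 2 := h1.trans (h2.trans h3.le)
  exact (pow_le_pow_iff_left₀ (norm_nonneg _) (by positivity) two_ne_zero).mp h4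

/-! ## §3 The (R7♭) letter of the brick-2 right inverse -/

/-- **(R7♭) — THE FINE CURVATURE OF THE EXACT RIGHT INVERSE IS BOUNDED BY THE COARSE CURVATURE OF ITS DATUM**, uniformly in `n = L^{j+1}` and the torus:
if every entry of the coarse plaquette field is bounded, `‖Fs M 1 B_{ij} μ ν y‖ ≤ f`, then at every fine point and plane
`‖curlAt flat (A_H + dPot (interp n univ (framePot L (j+1) A_H))) z μ ν‖ ≤ card n·(C_LIN(d)∕n)·f`, `A_H` the entrywise pull-back of `H_kB`,
`C_LIN(d) = 2·CdecD d·((d+1)(2(d+1))(2 + 32∕κ′²)·K_{d+1}(κ′∕2))`, `κ′ = kappa163(d+1)∕(d+1)` (gen 65). [folklore] -/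
theorem norm_curlAt_flat_hkRightInverse_le [Nonempty n] (L j : ℕ) [NeZero (L ^ (j + 1))] (M : Fin (d + 1) → ℕ) [∀ μ, NeZero (M μ)]
    (B : Tor M × Fin (d + 1) → Matrix n n ℂ) {f : ℝ}
    (hF : ∀ (i i' : n) (y : Tor M) (μ ν : Fin (d + 1)), ‖Fs M 1 (fun p : Tor M × Fin (d + 1) => B p i i') μ ν y‖ ≤ f)
    (z : Site (d + 1)) (μ ν : Fin (d + 1)) :
    ‖curlAt (flat (d := d + 1) (n := n))
        ((fun (x : Site (d + 1)) (κ : Fin (d + 1)) => Matrix.of fun i i' : n =>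
            (HkOp (L ^ (j + 1)) M *ᵥ fun p : Tor M × Fin (d + 1) => B p i i') (toT (fine (L ^ (j + 1)) M) x, κ))
          + dPot (interp (L ^ (j + 1)) Finset.univ (framePot L (j + 1)
              (fun (x : Site (d + 1)) (κ : Fin (d + 1)) => Matrix.of fun i i' : n =>
                (HkOp (L ^ (j + 1)) M *ᵥ fun p : Tor M × Fin (d + 1) => B p i i') (toT (fine (L ^ (j + 1)) M) x, κ)))))
        z μ ν‖
      ≤ Fintype.card n * ((2 * (CdecD d * (((d : ℝ) + 1) * (2 * ((d : ℝ) + 1))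
          * ((2 + 32 / (kappa163 (d + 1) / (d + 1)) ^ 2) * latticeConst (d + 1) (kappa163 (d + 1) / (d + 1) / 2)))))
          / ((L ^ (j + 1) : ℕ) : ℝ) * f) := by
  set nn : ℕ := L ^ (j + 1) with hnn
  set C : ℝ := 2 * (CdecD d * (((d : ℝ) + 1) * (2 * ((d : ℝ) + 1))
          * ((2 + 32 / (kappa163 (d + 1) / (d + 1)) ^ 2) * latticeConst (d + 1) (kappa163 (d + 1) / (d + 1) / 2)))) with hC
  -- the corrector is curl-free
  rw [curlAt_flat_add, curlAt_flat_dPot, add_zero]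
  refine opNorm_le_card_mul _ fun i i' => ?_
  -- entry (i,i') of the flat curl of the pull-back is `Fs (fine) 1 (H_k B_{ii'})` at `toT z`
  rw [curlAt_flat_pullback_entry (fine nn M) (fun i i' => HkOp nn M *ᵥ fun p : Tor M × Fin (d + 1) => B p i i') z μ ν i i']
  have hn0 : (nn : ℂ) ≠ 0 := by exact_mod_cast (NeZero.ne nn)
  rw [Fs_one_eq (fine nn M) hn0, norm_mul, norm_inv, Complex.norm_natCast]
  have h65 := norm_curl_HkOp_le_curl nn M (fun p : Tor M × Fin (d + 1) => B p i i') (fun y μ' ν' => hF i i' y μ' ν') (toT (fine nn M) z) μ ν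
  rw [← hC] at h65
  have hnpos : (0 : ℝ) < (nn : ℝ) := by exact_mod_cast Nat.pos_of_ne_zero (NeZero.ne nn)
  calc ((nn : ℝ))⁻¹ * ‖Fs (fine nn M) (nn : ℂ) (HkOp nn M *ᵥ fun p : Tor M × Fin (d + 1) => B p i i') μ ν (toT (fine nn M) z)‖
      ≤ ((nn : ℝ))⁻¹ * (C * f) := mul_le_mul_of_nonneg_left h65 (by positivity)
    _ = C / (nn : ℝ) * f := by field_simp

/-! ## §4 The T4-native form: datum = a periodic coarse T4 field, bound = its flat curl -/

omit [Fintype n] [DecidableEq n] in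
/-- A `P`-periodic direction field (T4's `IsPeriodicDir`) is invariant under every period vector of the cubic torus `M = (P,…,P)`. [folklore] -/
theorem apply_add_of_isPeriod {P : ℕ} {φ : Site (d + 1) → Fin (d + 1) → Matrix n n ℂ}
    (hφP : AveragingDeficitPeriodicCounting.IsPeriodicDir φ (P : ℤ)) {v : Site (d + 1)}
    (hv : B6Lemma24Torus.IsPeriod (fun _ : Fin (d + 1) => P) v) (x : Site (d + 1)) (κ : Fin (d + 1)) : φ (x + v) κ = φ x κ := by
  have hk : v = (P : ℤ) • fun i => v i / (P : ℤ) := by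
    funext i
    obtain ⟨c, hc⟩ := hv i
    simp only [Pi.smul_apply, smul_eq_mul]
    rw [hc]
    by_cases hP : (P : ℤ) = 0
    · rw [hP]; simp
    · rw [Int.mul_ediv_cancel_left _ hP]
  rw [hk]
  exact AveragingDeficitTorusChart.periodic_smul_vec (f := fun y => φ y κ) (fun y i => hφP y i κ) x _

omit [Fintype n] [DecidableEq n] in
/-- … hence it reads through `rep ∘ toT`: `φ (rep (toT x)) = φ x`, and `φ (rep (y + u_μ)) = φ (rep y + e_μ)`. [folklore] -/
theorem apply_rep_toT {P : ℕ} [NeZero P] {φ : Site (d + 1) → Fin (d + 1) → Matrix n n ℂ}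
    (hφP : AveragingDeficitPeriodicCounting.IsPeriodicDir φ (P : ℤ)) (x : Site (d + 1)) (κ : Fin (d + 1)) :
    φ (B6LowerBound2153Torus.rep (fun _ : Fin (d + 1) => P) (toT (fun _ : Fin (d + 1) => P) x)) κ = φ x κ := by
  have h := B6LowerBound2153Torus.isPeriod_rep_toT_sub (fun _ : Fin (d + 1) => P) x
  have e1 : B6LowerBound2153Torus.rep (fun _ : Fin (d + 1) => P) (toT (fun _ : Fin (d + 1) => P) x)
      = x + (B6LowerBound2153Torus.rep (fun _ : Fin (d + 1) => P) (toT (fun _ : Fin (d + 1) => P) x) - x) := by abel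
  rw [e1, apply_add_of_isPeriod hφP h]

omit [Fintype n] [DecidableEq n] in
/-- `φ (rep (y + unitVec μ)) = φ (rep y + e_μ)` for a `P`-periodic `φ`. [folklore] -/
theorem apply_rep_add_unitVec {P : ℕ} [NeZero P] {φ : Site (d + 1) → Fin (d + 1) → Matrix n n ℂ}
    (hφP : AveragingDeficitPeriodicCounting.IsPeriodicDir φ (P : ℤ)) (y : Tor (fun _ : Fin (d + 1) => P)) (μ κ : Fin (d + 1)) :
    φ (B6LowerBound2153Torus.rep (fun _ : Fin (d + 1) => P) (y + B5Prop11Plancherel.unitVec (fun _ : Fin (d + 1) => P) μ)) κ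
      = φ (B6LowerBound2153Torus.rep (fun _ : Fin (d + 1) => P) y + e μ) κ := by
  have h1 : toT (fun _ : Fin (d + 1) => P) (B6LowerBound2153Torus.rep (fun _ : Fin (d + 1) => P) y + e μ)
      = y + B5Prop11Plancherel.unitVec (fun _ : Fin (d + 1) => P) μ := by
    rw [toT_add_e', B6LowerBound2153Torus.toT_rep]
  rw [← h1, apply_rep_toT hφP]

/-- **(R7♭) IN THE T4 DICTIONARY.**  Let `φ` be a `P`-periodic coarse field on `ℤ^{d+1}` with `‖curlAt flat φ y μ ν‖ ≤ g` everywhere, `n = L^{j+1} ≥ 1`, and let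
`B(y,κ) := n⁻¹•φ(rep y, κ)` on the cubic torus `(P,…,P)`.  Then brick 2's right inverse `R := A_H + dPot (interp n univ (framePot L (j+1) A_H))`
(`A_H` the entrywise pull-back of `H_kB`) satisfies (a) `cpushIter L j flat R = φ` and (b) `‖curlAt flat R z μ ν‖ ≤ card n·C_LIN(d)·n⁻²·g` at every fine point
and plane — an EXACT right inverse of the T4 linearised `(j+1)`-fold average at `U = 1` whose FINE CURVATURE is `O(n⁻²)` times the COARSE CURVATURE of the
datum, k-UNIFORM.  This is the (R7) letter of memo H13 §5 (ii) at the untwisted flat background. [folklore] -/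
theorem rightInverse_flat_curl_le [Nonempty n] {L : ℕ} (hL : 1 ≤ L) (j : ℕ) (P : ℕ) [NeZero P] [NeZero (L ^ (j + 1))]
    (φ : Site (d + 1) → Fin (d + 1) → Matrix n n ℂ) (hφP : AveragingDeficitPeriodicCounting.IsPeriodicDir φ (P : ℤ))
    {g : ℝ} (hg : ∀ (y : Site (d + 1)) (μ ν : Fin (d + 1)), ‖curlAt (flat (d := d + 1) (n := n)) φ y μ ν‖ ≤ g) :
    ReplicationRightInverse.cpushIter L j (flat (d := d + 1) (n := n))
        ((fun (x : Site (d + 1)) (κ : Fin (d + 1)) => Matrix.of fun i i' : n =>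
      (HkOp (L ^ (j + 1)) (fun _ : Fin (d + 1) => P) *ᵥ fun p : Tor (fun _ : Fin (d + 1) => P) × Fin (d + 1) => (fun p : Tor (fun _ : Fin (d + 1) => P) × Fin (d + 1) => (((L ^ (j + 1) : ℕ) : ℂ))⁻¹ • φ (B6LowerBound2153Torus.rep (fun _ : Fin (d + 1) => P) p.1) p.2) p i i') (toT (fine (L ^ (j + 1)) (fun _ : Fin (d + 1) => P)) x, κ))
          + dPot (interp (L ^ (j + 1)) Finset.univ (framePot L (j + 1)
            (fun (x : Site (d + 1)) (κ : Fin (d + 1)) => Matrix.of fun i i' : n =>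
      (HkOp (L ^ (j + 1)) (fun _ : Fin (d + 1) => P) *ᵥ fun p : Tor (fun _ : Fin (d + 1) => P) × Fin (d + 1) => (fun p : Tor (fun _ : Fin (d + 1) => P) × Fin (d + 1) => (((L ^ (j + 1) : ℕ) : ℂ))⁻¹ • φ (B6LowerBound2153Torus.rep (fun _ : Fin (d + 1) => P) p.1) p.2) p i i') (toT (fine (L ^ (j + 1)) (fun _ : Fin (d + 1) => P)) x, κ))))) = φ ∧
      ∀ (z : Site (d + 1)) (μ ν : Fin (d + 1)),
        ‖curlAt (flat (d := d + 1) (n := n))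
            ((fun (x : Site (d + 1)) (κ : Fin (d + 1)) => Matrix.of fun i i' : n =>
      (HkOp (L ^ (j + 1)) (fun _ : Fin (d + 1) => P) *ᵥ fun p : Tor (fun _ : Fin (d + 1) => P) × Fin (d + 1) => (fun p : Tor (fun _ : Fin (d + 1) => P) × Fin (d + 1) => (((L ^ (j + 1) : ℕ) : ℂ))⁻¹ • φ (B6LowerBound2153Torus.rep (fun _ : Fin (d + 1) => P) p.1) p.2) p i i') (toT (fine (L ^ (j + 1)) (fun _ : Fin (d + 1) => P)) x, κ))
              + dPot (interp (L ^ (j + 1)) Finset.univ (framePot L (j + 1)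
                (fun (x : Site (d + 1)) (κ : Fin (d + 1)) => Matrix.of fun i i' : n =>
      (HkOp (L ^ (j + 1)) (fun _ : Fin (d + 1) => P) *ᵥ fun p : Tor (fun _ : Fin (d + 1) => P) × Fin (d + 1) => (fun p : Tor (fun _ : Fin (d + 1) => P) × Fin (d + 1) => (((L ^ (j + 1) : ℕ) : ℂ))⁻¹ • φ (B6LowerBound2153Torus.rep (fun _ : Fin (d + 1) => P) p.1) p.2) p i i') (toT (fine (L ^ (j + 1)) (fun _ : Fin (d + 1) => P)) x, κ))))) z μ ν‖
          ≤ Fintype.card n * ((2 * (CdecD d * (((d : ℝ) + 1) * (2 * ((d : ℝ) + 1))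
              * ((2 + 32 / (kappa163 (d + 1) / (d + 1)) ^ 2) * latticeConst (d + 1) (kappa163 (d + 1) / (d + 1) / 2)))))
              / ((L ^ (j + 1) : ℕ) : ℝ) * (g / ((L ^ (j + 1) : ℕ) : ℝ))) := by
  have hn0 : ((L ^ (j + 1) : ℕ) : ℂ) ≠ 0 := by exact_mod_cast (NeZero.ne (L ^ (j + 1)))
  have hnpos : (0 : ℝ) < ((L ^ (j + 1) : ℕ) : ℝ) := by exact_mod_cast Nat.pos_of_ne_zero (NeZero.ne (L ^ (j + 1)))
  refine ⟨?_, fun z μ ν => ?_⟩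
  · -- (a) exactness: F36 + periodicity
    rw [NE7FlatHkRightInverse.cpushIter_flat_hkPull hL j (fun _ : Fin (d + 1) => P) (fun p : Tor (fun _ : Fin (d + 1) => P) × Fin (d + 1) => (((L ^ (j + 1) : ℕ) : ℂ))⁻¹ • φ (B6LowerBound2153Torus.rep (fun _ : Fin (d + 1) => P) p.1) p.2)]
    funext z κ
    show (((L ^ (j + 1) : ℕ) : ℂ)) • ((((L ^ (j + 1) : ℕ) : ℂ))⁻¹ • φ (B6LowerBound2153Torus.rep (fun _ : Fin (d + 1) => P) (toT (fun _ : Fin (d + 1) => P) z)) κ) = φ z κ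
    rw [smul_smul, mul_inv_cancel₀ hn0, one_smul, apply_rep_toT hφP]
  · -- (b) the curl letter: §3 with `f := g/n`
    refine norm_curlAt_flat_hkRightInverse_le L j (fun _ : Fin (d + 1) => P) (fun p : Tor (fun _ : Fin (d + 1) => P) × Fin (d + 1) => (((L ^ (j + 1) : ℕ) : ℂ))⁻¹ • φ (B6LowerBound2153Torus.rep (fun _ : Fin (d + 1) => P) p.1) p.2)
      (f := g / ((L ^ (j + 1) : ℕ) : ℝ)) (fun i i' y μ' ν' => ?_) z μ ν
    have hFs : Fs (fun _ : Fin (d + 1) => P) 1 (fun p : Tor (fun _ : Fin (d + 1) => P) × Fin (d + 1) => (fun p : Tor (fun _ : Fin (d + 1) => P) × Fin (d + 1) => (((L ^ (j + 1) : ℕ) : ℂ))⁻¹ • φ (B6LowerBound2153Torus.rep (fun _ : Fin (d + 1) => P) p.1) p.2) p i i') μ' ν' y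
        = (((L ^ (j + 1) : ℕ) : ℂ))⁻¹ * curlAt (flat (d := d + 1) (n := n)) φ (B6LowerBound2153Torus.rep (fun _ : Fin (d + 1) => P) y) μ' ν' i i' := by
      rw [Fs_apply, curlAt_flat_eq, one_mul]
      simp only [Matrix.smul_apply, smul_eq_mul, Matrix.sub_apply]
      rw [apply_rep_add_unitVec hφP y μ' ν', apply_rep_add_unitVec hφP y ν' μ']
      ring
    rw [hFs, norm_mul, norm_inv, Complex.norm_natCast]
    have h1 := norm_apply_le_norm (curlAt (flat (d := d + 1) (n := n)) φ (B6LowerBound2153Torus.rep (fun _ : Fin (d + 1) => P) y) μ' ν') i i'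
    have h2 := hg (B6LowerBound2153Torus.rep (fun _ : Fin (d + 1) => P) y) μ' ν'
    rw [div_eq_inv_mul]
    exact mul_le_mul_of_nonneg_left (h1.trans h2) (by positivity)

end

end Summit.QuantumFields.BalabanUV.T4Continuum.NE7FlatHkCurlLetter

-- Build-lane re-trigger (custody by lineage t4-ne7-p2, gen 85, 2026-08-24; the file F37 and its pid of record p380128 are the OWNER t4-ne7-p1's):
-- comment-only re-land of the tree bytes c601ffd21009c95a; every declaration byte-identical.  Accepted 2026-08-24T13:11Z, never built
-- (`ops/buildfix/UNBUILT-ACCEPTED-20260824T1600.txt` l.1559: last build event rc 75 NO-HOST, attempt 63); THE END F54 v3 imports this module.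
-- Cf. ops-buildfix-2's comment-only re-land p372431 of `B7Prop4Flat`.
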